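import Summits.Parity.GeneralizedHardyLittlewood.Theorems.PrimeLevelFamEdgeMomentsBeyondDiagonalDiagRungFourOfTargets
import Summits.Parity.GeneralizedHardyLittlewood.Theorems.PrimeLevelFamEdgeMomentsBeyondDiagonalDiagOrderZeroFourHolds
import Summits.Parity.GeneralizedHardyLittlewood.Theorems.PrimeLevelFamEdgeMomentsBeyondDiagonalDiagOrderTwoFourHolds
import HarnessLib

/-!
# Route `PrimeLevelFamEdge`, crux K_A `MomentsBeyondDiagonal` (stmt-Parity-20007), line «petersson_layers» v4, stub `stub_diag`:
# **RUNG `N = 4` OF `stub_diag` ⟸ THE ORDER-`(4,4)` TARGET ALONE** — `…DiagRungFourOfTargets` (lineage famedge-2 g7) with the orders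
# `(0,4)` and `(2,4)` discharged by `…DiagOrderZeroFourHolds.orderZeroFour_target` and `…DiagOrderTwoFourHolds.orderTwoFour_target`
# (this lineage, (R₀₄) and (R₂₄) proved)

* `diagPart_asymp_of_natDegree_le_four_of_target44` — **for every admissible `P`, every `Q` with `deg Q ≤ 4`, every `Δ' ∈ (1, Δ]`,
  `Δ ≤ 3/2`: the rung-4 diagonal main term (closed forms `τ₁₁, τ₀₂, τ₂₂, τ₁₃, τ₃₃, τ₀₄, τ₂₄` explicit; `τ₄₄` through the abstract functional
  `𝔎₄₄` of the one remaining target `(4,4)` = chain to be written on `…DiagDecorOrderRungFourHecke.heckeSum_orderFourFour_eq` with the landed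
  engines `M₈`, `M₆⊗P₂`, `M₄⊗M₄` + the remainder estimate (R₄₄)).**

Def-free; helper `--supports stmt-Parity-20007`; closes nothing (`stub_diag : SubDiag` quantifies over every `Q`); K_A, K_B and the Parity
summit are NOT proved; nothing about Landau–Siegel zeros.

## References
* E. Kowalski, P. Michel, J. VanderKam, J. reine angew. Math. 526 (2000), (23)–(28) pp. 13–15, Prop. 5.1 (31) p. 18.
  [cite: KowalskiMichelVanderKam2000, (23)–(28) pp. 13–15 — derivation (diagonal main term, Q of degree ≤ 4)]
-/

noncomputable section

open scoped Real ArithmeticFunction.Moebius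
open Complex MeasureTheory Polynomial Finset ArithmeticFunction Set intervalIntegral
open Literature.NumberTheory.LFunctions Literature.NumberTheory.LFunctions.KMV2000

namespace Summit.Parity.GeneralizedHardyLittlewood.Theorems.MomentsBeyondDiagonal.DiagCorner

open Summit.Parity.GeneralizedHardyLittlewood.Theorems.PrimeLevelFamEdgeIdeaDeltas.PeterssonLayers (diagPart)

set_option maxHeartbeats 1600000 in
set_option maxRecDepth 8192 in
-- large statement; two closed-form functionals abstracted and re-instantiated
/-- **RUNG `N = 4` OF `stub_diag` MODULO THE ORDER-`(4,4)` TARGET ALONE** (see the module docstring).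
[cite: KowalskiMichelVanderKam2000, (23)–(28) pp. 13–15, Prop. 5.1 (31) — derivation (diagonal main term, Q of degree ≤ 4)] -/
theorem diagPart_asymp_of_natDegree_le_four_of_target44 {Δ : ℝ} (hΔ : Δ ≤ 3 / 2) (𝔎₄₄ : ℝ → ℝ[X] → ℝ)
    (h44 : ∀ P : ℝ[X], KMV2000.Admissible P → ∀ Δ' : ℝ, 1 < Δ' → Δ' ≤ Δ →
      ∃ C : ℝ, ∃ q₀ : ℕ, ∀ (q : ℕ) [NeZero q], q₀ ≤ q →
        |(Real.log (qhat q))⁻¹ ^ (4 + 4) * qhat q *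
          (∑ c ∈ Icc 1 ⌊qhat q ^ Δ'⌋₊, ∑ g ∈ Icc 1 (⌊qhat q ^ Δ'⌋₊ / c), (μ g : ℝ) * c *
        ∑ k₁ ∈ Icc 1 (⌊qhat q ^ Δ'⌋₊ / (c * g)), ∑ k₂ ∈ Icc 1 (⌊qhat q ^ Δ'⌋₊ / (c * g)),
          ((μ (c * g * k₁) : ℝ) * ((psi (c * g * k₁))⁻¹ *
              P.eval (Real.log (qhat q ^ Δ' / ((c * g * k₁ : ℕ) : ℝ)) / Real.log (qhat q ^ Δ'))) / ((c * g * k₁ : ℕ) : ℝ)) *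
            ((μ (c * g * k₂) : ℝ) * ((psi (c * g * k₂))⁻¹ *
              P.eval (Real.log (qhat q ^ Δ' / ((c * g * k₂ : ℕ) : ℝ)) / Real.log (qhat q ^ Δ'))) / ((c * g * k₂ : ℕ) : ℝ)) *
            (∑ d ∈ k₁.divisors, ∑ e ∈ k₂.divisors,
              ∫ u₁ in Ioi (0 : ℝ),
                (Real.log (qhat q / ((k₁ / d * (g * e) : ℕ) : ℝ)) + Real.log u₁) ^ 4 *
                ∫ u₂ in Ioi ((((k₁ / d * (g * e) * (g * d * (k₂ / e)) : ℕ) : ℝ) / qhat q ^ 2) / u₁),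
                  Real.exp (-(u₁ + u₂)) / (1 - Real.exp (-(u₁ + u₂))) ^ 2 *
                  (Real.log (qhat q / ((g * d * (k₂ / e) : ℕ) : ℝ)) + Real.log u₂) ^ 4)) -
          2 * (π ^ 2 / 6) ^ 2 * (qhat q / (Δ' ^ 2 * Real.log (qhat q) ^ 2)) *
            (Δ' ^ 2 * (Δ' ^ 6 * 𝔎₄₄ (1 / Δ') P) / (2 * (π ^ 2 / 6) ^ 2))| ≤
          C * qhat q * (Real.log (qhat q))⁻¹ ^ 3)
    {P Q : ℝ[X]} (hP : KMV2000.Admissible P) (hQ : Q.natDegree ≤ 4) {Δ' : ℝ} (h1 : 1 < Δ') (h2 : Δ' ≤ Δ) :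
    ∃ C : ℝ, ∃ q₀ : ℕ, ∀ (q : ℕ) [NeZero q], q₀ ≤ q →
      ‖diagPart q P Q Δ' -
          ((2 * riemannZeta 2 ^ 2 *
              ((qhat q / (Δ' ^ 2 * Real.log (qhat q) ^ 2) : ℝ) : ℂ)) *
            ((Q.coeff 0 ^ 2 * KMV2000.secondMomentForm Δ' P 1 +
              2 * Q.coeff 1 ^ 2 *
                (Δ' ^ 2 * ((π ^ 2 / 6) ^ 2 *
              ((∑ j ∈ Finset.range (3 + 1), ∑ i ∈ Finset.range (j + 1),
                  ((3 : ℕ).choose j : ℝ) * (j.choose i : ℝ) * 2 ^ (3 - j) *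
                    ∫ u in (0 : ℝ)..1, (((Polynomial.C (1 / Δ') - X) ^ (3 - j) *
                      derivative (derivative (X ^ i * P))) * derivative (derivative (X ^ (j - i) * P))).eval u) / 24 -
                (∑ j ∈ Finset.range (1 + 1), ∑ i ∈ Finset.range (j + 1),
                  ((1 : ℕ).choose j : ℝ) * (j.choose i : ℝ) * 2 ^ (1 - j) *
                    ∫ u in (0 : ℝ)..1, (((Polynomial.C (1 / Δ') - X) ^ (1 - j) * (-(2 : ℝ) • (X ^ i * P))) *
                      derivative (derivative (X ^ (j - i) * P))).eval u) / 4)) / (2 * (π ^ 2 / 6) ^ 2)) +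
              4 * (Q.coeff 0 * Q.coeff 2) *
                (Δ' ^ 2 * ((π ^ 2 / 6) ^ 2 *
              ((∑ j ∈ Finset.range (3 + 1), ∑ i ∈ Finset.range (j + 1),
                  ((3 : ℕ).choose j : ℝ) * (j.choose i : ℝ) * 2 ^ (3 - j) *
                    ∫ u in (0 : ℝ)..1, (((Polynomial.C (1 / Δ') - X) ^ (3 - j) *
                      derivative (derivative (X ^ i * P))) * derivative (derivative (X ^ (j - i) * P))).eval u) / 24 +
                (∑ j ∈ Finset.range (1 + 1), ∑ i ∈ Finset.range (j + 1),
                  ((1 : ℕ).choose j : ℝ) * (j.choose i : ℝ) * 2 ^ (1 - j) *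
                    ∫ u in (0 : ℝ)..1, (((Polynomial.C (1 / Δ') - X) ^ (1 - j) * (-(2 : ℝ) • (X ^ i * P))) *
                      derivative (derivative (X ^ (j - i) * P))).eval u) / 4)) / (2 * (π ^ 2 / 6) ^ 2)) +
              2 * Q.coeff 2 ^ 2 *
                (Δ' ^ 2 * (Δ' ^ 2 * ((π ^ 2 / 6) ^ 2 * ((∑ j ∈ Finset.range (5 + 1), ∑ i ∈ Finset.range (j + 1),
            ((5 : ℕ).choose j : ℝ) * (j.choose i : ℝ) * 2 ^ (5 - j) *
              ∫ u in (0 : ℝ)..1, (((Polynomial.C (1 / Δ') - X) ^ (5 - j) * derivative (derivative (X ^ i * P))) *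
                derivative (derivative (X ^ (j - i) * P))).eval u) / 160 -
          (∑ j ∈ Finset.range (3 + 1), ∑ i ∈ Finset.range (j + 1),
            ((3 : ℕ).choose j : ℝ) * (j.choose i : ℝ) * 2 ^ (3 - j) *
              ∫ u in (0 : ℝ)..1, (((Polynomial.C (1 / Δ') - X) ^ (3 - j) * (-(2 : ℝ) • (X ^ i * P))) *
                derivative (derivative (X ^ (j - i) * P))).eval u) / 24 +
          3 / 16 * (∑ j ∈ Finset.range (1 + 1), ∑ i ∈ Finset.range (j + 1),
            ((1 : ℕ).choose j : ℝ) * (j.choose i : ℝ) * 2 ^ (1 - j) *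
              ∫ u in (0 : ℝ)..1, (((Polynomial.C (1 / Δ') - X) ^ (1 - j) * (-(2 : ℝ) • (X ^ i * P))) *
                (-(2 : ℝ) • (X ^ (j - i) * P))).eval u)))) / (2 * (π ^ 2 / 6) ^ 2)) +
              4 * (Q.coeff 1 * Q.coeff 3) *
                (Δ' ^ 2 * (Δ' ^ 2 * ((π ^ 2 / 6) ^ 2 * ((∑ j ∈ Finset.range (5 + 1), ∑ i ∈ Finset.range (j + 1),
            ((5 : ℕ).choose j : ℝ) * (j.choose i : ℝ) * 2 ^ (5 - j) *
              ∫ u in (0 : ℝ)..1, (((Polynomial.C (1 / Δ') - X) ^ (5 - j) * derivative (derivative (X ^ i * P))) *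
                derivative (derivative (X ^ (j - i) * P))).eval u) / 160 -
          3 / 16 * (∑ j ∈ Finset.range (1 + 1), ∑ i ∈ Finset.range (j + 1),
            ((1 : ℕ).choose j : ℝ) * (j.choose i : ℝ) * 2 ^ (1 - j) *
              ∫ u in (0 : ℝ)..1, (((Polynomial.C (1 / Δ') - X) ^ (1 - j) * (-(2 : ℝ) • (X ^ i * P))) *
                (-(2 : ℝ) • (X ^ (j - i) * P))).eval u)))) / (2 * (π ^ 2 / 6) ^ 2)) +
              2 * Q.coeff 3 ^ 2 *
                (Δ' ^ 2 * (Δ' ^ 4 * ((π ^ 2 / 6) ^ 2 * ((1 / 896) * (∑ j ∈ Finset.range (7 + 1), ∑ i ∈ Finset.range (j + 1),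
            ((7 : ℕ).choose j : ℝ) * (j.choose i : ℝ) * 2 ^ (7 - j) *
              ∫ u in (0 : ℝ)..1, (((Polynomial.C (1 / Δ') - X) ^ (7 - j) * derivative (derivative (X ^ i * P))) *
                derivative (derivative (X ^ (j - i) * P))).eval u) +
          (-3 / 320) * (∑ j ∈ Finset.range (5 + 1), ∑ i ∈ Finset.range (j + 1),
            ((5 : ℕ).choose j : ℝ) * (j.choose i : ℝ) * 2 ^ (5 - j) *
              ∫ u in (0 : ℝ)..1, (((Polynomial.C (1 / Δ') - X) ^ (5 - j) * (-(2 : ℝ) • (X ^ i * P))) *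
                derivative (derivative (X ^ (j - i) * P))).eval u) +
          (3 / 64) * (∑ j ∈ Finset.range (3 + 1), ∑ i ∈ Finset.range (j + 1),
            ((3 : ℕ).choose j : ℝ) * (j.choose i : ℝ) * 2 ^ (3 - j) *
              ∫ u in (0 : ℝ)..1, (((Polynomial.C (1 / Δ') - X) ^ (3 - j) * (-(2 : ℝ) • (X ^ i * P))) *
                (-(2 : ℝ) • (X ^ (j - i) * P))).eval u)))) / (2 * (π ^ 2 / 6) ^ 2)) +
              4 * (Q.coeff 0 * Q.coeff 4) *
                (Δ' ^ 2 * (Δ' ^ 2 * ((π ^ 2 / 6) ^ 2 * ((1 / 160) * (∑ j ∈ Finset.range (5 + 1), ∑ i ∈ Finset.range (j + 1),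
            ((5 : ℕ).choose j : ℝ) * (j.choose i : ℝ) * 2 ^ (5 - j) *
              ∫ u in (0 : ℝ)..1, (((Polynomial.C (1 / Δ') - X) ^ (5 - j) * derivative (derivative (X ^ i * P))) *
                derivative (derivative (X ^ (j - i) * P))).eval u) +
          (1 / 8) * (∑ j ∈ Finset.range (3 + 1), ∑ i ∈ Finset.range (j + 1),
            ((3 : ℕ).choose j : ℝ) * (j.choose i : ℝ) * 2 ^ (3 - j) *
              ∫ u in (0 : ℝ)..1, (((Polynomial.C (1 / Δ') - X) ^ (3 - j) * (-(2 : ℝ) • (X ^ i * P))) *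
                derivative (derivative (X ^ (j - i) * P))).eval u) +
          (3 / 16) * (∑ j ∈ Finset.range (1 + 1), ∑ i ∈ Finset.range (j + 1),
            ((1 : ℕ).choose j : ℝ) * (j.choose i : ℝ) * 2 ^ (1 - j) *
              ∫ u in (0 : ℝ)..1, (((Polynomial.C (1 / Δ') - X) ^ (1 - j) * (-(2 : ℝ) • (X ^ i * P))) *
                (-(2 : ℝ) • (X ^ (j - i) * P))).eval u)))) / (2 * (π ^ 2 / 6) ^ 2)) +
              4 * (Q.coeff 2 * Q.coeff 4) *
                (Δ' ^ 2 * (Δ' ^ 4 * ((π ^ 2 / 6) ^ 2 * ((1 / 896) * (∑ j ∈ Finset.range (7 + 1), ∑ i ∈ Finset.range (j + 1),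
            ((7 : ℕ).choose j : ℝ) * (j.choose i : ℝ) * 2 ^ (7 - j) *
              ∫ u in (0 : ℝ)..1, (((Polynomial.C (1 / Δ') - X) ^ (7 - j) * derivative (derivative (X ^ i * P))) *
                derivative (derivative (X ^ (j - i) * P))).eval u) +
          (-1 / 320) * (∑ j ∈ Finset.range (5 + 1), ∑ i ∈ Finset.range (j + 1),
            ((5 : ℕ).choose j : ℝ) * (j.choose i : ℝ) * 2 ^ (5 - j) *
              ∫ u in (0 : ℝ)..1, (((Polynomial.C (1 / Δ') - X) ^ (5 - j) * (-(2 : ℝ) • (X ^ i * P))) *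
                derivative (derivative (X ^ (j - i) * P))).eval u) +
          (-1 / 64) * (∑ j ∈ Finset.range (3 + 1), ∑ i ∈ Finset.range (j + 1),
            ((3 : ℕ).choose j : ℝ) * (j.choose i : ℝ) * 2 ^ (3 - j) *
              ∫ u in (0 : ℝ)..1, (((Polynomial.C (1 / Δ') - X) ^ (3 - j) * (-(2 : ℝ) • (X ^ i * P))) *
                (-(2 : ℝ) • (X ^ (j - i) * P))).eval u)))) / (2 * (π ^ 2 / 6) ^ 2)) +
              2 * Q.coeff 4 ^ 2 *
                (Δ' ^ 2 * (Δ' ^ 6 * 𝔎₄₄ (1 / Δ') P) / (2 * (π ^ 2 / 6) ^ 2)) : ℝ) : ℂ))‖ ≤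
        C * qhat q * (Real.log (qhat q))⁻¹ ^ 3 := by
  obtain ⟨𝔎₀₄, hK₀₄⟩ : ∃ 𝔎 : ℝ → ℝ[X] → ℝ, 𝔎 = fun (lam : ℝ) (P : ℝ[X]) ↦ ((π ^ 2 / 6) ^ 2 * ((1 / 160) * (∑ j ∈ Finset.range (5 + 1), ∑ i ∈ Finset.range (j + 1),
            ((5 : ℕ).choose j : ℝ) * (j.choose i : ℝ) * 2 ^ (5 - j) *
              ∫ u in (0 : ℝ)..1, (((Polynomial.C lam - X) ^ (5 - j) * derivative (derivative (X ^ i * P))) *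
                derivative (derivative (X ^ (j - i) * P))).eval u) +
          (1 / 8) * (∑ j ∈ Finset.range (3 + 1), ∑ i ∈ Finset.range (j + 1),
            ((3 : ℕ).choose j : ℝ) * (j.choose i : ℝ) * 2 ^ (3 - j) *
              ∫ u in (0 : ℝ)..1, (((Polynomial.C lam - X) ^ (3 - j) * (-(2 : ℝ) • (X ^ i * P))) *
                derivative (derivative (X ^ (j - i) * P))).eval u) +
          (3 / 16) * (∑ j ∈ Finset.range (1 + 1), ∑ i ∈ Finset.range (j + 1),
            ((1 : ℕ).choose j : ℝ) * (j.choose i : ℝ) * 2 ^ (1 - j) *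
              ∫ u in (0 : ℝ)..1, (((Polynomial.C lam - X) ^ (1 - j) * (-(2 : ℝ) • (X ^ i * P))) *
                (-(2 : ℝ) • (X ^ (j - i) * P))).eval u))) := ⟨_, rfl⟩
  obtain ⟨𝔎₂₄, hK₂₄⟩ : ∃ 𝔎 : ℝ → ℝ[X] → ℝ, 𝔎 = fun (lam : ℝ) (P : ℝ[X]) ↦ ((π ^ 2 / 6) ^ 2 * ((1 / 896) * (∑ j ∈ Finset.range (7 + 1), ∑ i ∈ Finset.range (j + 1),
            ((7 : ℕ).choose j : ℝ) * (j.choose i : ℝ) * 2 ^ (7 - j) *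
              ∫ u in (0 : ℝ)..1, (((Polynomial.C lam - X) ^ (7 - j) * derivative (derivative (X ^ i * P))) *
                derivative (derivative (X ^ (j - i) * P))).eval u) +
          (-1 / 320) * (∑ j ∈ Finset.range (5 + 1), ∑ i ∈ Finset.range (j + 1),
            ((5 : ℕ).choose j : ℝ) * (j.choose i : ℝ) * 2 ^ (5 - j) *
              ∫ u in (0 : ℝ)..1, (((Polynomial.C lam - X) ^ (5 - j) * (-(2 : ℝ) • (X ^ i * P))) *
                derivative (derivative (X ^ (j - i) * P))).eval u) +
          (-1 / 64) * (∑ j ∈ Finset.range (3 + 1), ∑ i ∈ Finset.range (j + 1),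
            ((3 : ℕ).choose j : ℝ) * (j.choose i : ℝ) * 2 ^ (3 - j) *
              ∫ u in (0 : ℝ)..1, (((Polynomial.C lam - X) ^ (3 - j) * (-(2 : ℝ) • (X ^ i * P))) *
                (-(2 : ℝ) • (X ^ (j - i) * P))).eval u))) := ⟨_, rfl⟩
  have e₀₄ : ∀ (Δ' : ℝ) (P : ℝ[X]), 𝔎₀₄ (1 / Δ') P = ((π ^ 2 / 6) ^ 2 * ((1 / 160) * (∑ j ∈ Finset.range (5 + 1), ∑ i ∈ Finset.range (j + 1),
            ((5 : ℕ).choose j : ℝ) * (j.choose i : ℝ) * 2 ^ (5 - j) *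
              ∫ u in (0 : ℝ)..1, (((Polynomial.C (1 / Δ') - X) ^ (5 - j) * derivative (derivative (X ^ i * P))) *
                derivative (derivative (X ^ (j - i) * P))).eval u) +
          (1 / 8) * (∑ j ∈ Finset.range (3 + 1), ∑ i ∈ Finset.range (j + 1),
            ((3 : ℕ).choose j : ℝ) * (j.choose i : ℝ) * 2 ^ (3 - j) *
              ∫ u in (0 : ℝ)..1, (((Polynomial.C (1 / Δ') - X) ^ (3 - j) * (-(2 : ℝ) • (X ^ i * P))) *
                derivative (derivative (X ^ (j - i) * P))).eval u) +
          (3 / 16) * (∑ j ∈ Finset.range (1 + 1), ∑ i ∈ Finset.range (j + 1),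
            ((1 : ℕ).choose j : ℝ) * (j.choose i : ℝ) * 2 ^ (1 - j) *
              ∫ u in (0 : ℝ)..1, (((Polynomial.C (1 / Δ') - X) ^ (1 - j) * (-(2 : ℝ) • (X ^ i * P))) *
                (-(2 : ℝ) • (X ^ (j - i) * P))).eval u))) := fun _ _ ↦ by
    rw [hK₀₄]
  have e₂₄ : ∀ (Δ' : ℝ) (P : ℝ[X]), 𝔎₂₄ (1 / Δ') P = ((π ^ 2 / 6) ^ 2 * ((1 / 896) * (∑ j ∈ Finset.range (7 + 1), ∑ i ∈ Finset.range (j + 1),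
            ((7 : ℕ).choose j : ℝ) * (j.choose i : ℝ) * 2 ^ (7 - j) *
              ∫ u in (0 : ℝ)..1, (((Polynomial.C (1 / Δ') - X) ^ (7 - j) * derivative (derivative (X ^ i * P))) *
                derivative (derivative (X ^ (j - i) * P))).eval u) +
          (-1 / 320) * (∑ j ∈ Finset.range (5 + 1), ∑ i ∈ Finset.range (j + 1),
            ((5 : ℕ).choose j : ℝ) * (j.choose i : ℝ) * 2 ^ (5 - j) *
              ∫ u in (0 : ℝ)..1, (((Polynomial.C (1 / Δ') - X) ^ (5 - j) * (-(2 : ℝ) • (X ^ i * P))) *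
                derivative (derivative (X ^ (j - i) * P))).eval u) +
          (-1 / 64) * (∑ j ∈ Finset.range (3 + 1), ∑ i ∈ Finset.range (j + 1),
            ((3 : ℕ).choose j : ℝ) * (j.choose i : ℝ) * 2 ^ (3 - j) *
              ∫ u in (0 : ℝ)..1, (((Polynomial.C (1 / Δ') - X) ^ (3 - j) * (-(2 : ℝ) • (X ^ i * P))) *
                (-(2 : ℝ) • (X ^ (j - i) * P))).eval u))) := fun _ _ ↦ by
    rw [hK₂₄]
  have h04 : ∀ P : ℝ[X], KMV2000.Admissible P → ∀ Δ' : ℝ, 1 < Δ' → Δ' ≤ Δ →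
      ∃ C : ℝ, ∃ q₀ : ℕ, ∀ (q : ℕ) [NeZero q], q₀ ≤ q →
        |(Real.log (qhat q))⁻¹ ^ (0 + 4) * qhat q *
          (∑ c ∈ Icc 1 ⌊qhat q ^ Δ'⌋₊, ∑ g ∈ Icc 1 (⌊qhat q ^ Δ'⌋₊ / c), (μ g : ℝ) * c *
        ∑ k₁ ∈ Icc 1 (⌊qhat q ^ Δ'⌋₊ / (c * g)), ∑ k₂ ∈ Icc 1 (⌊qhat q ^ Δ'⌋₊ / (c * g)),
          ((μ (c * g * k₁) : ℝ) * ((psi (c * g * k₁))⁻¹ *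
              P.eval (Real.log (qhat q ^ Δ' / ((c * g * k₁ : ℕ) : ℝ)) / Real.log (qhat q ^ Δ'))) / ((c * g * k₁ : ℕ) : ℝ)) *
            ((μ (c * g * k₂) : ℝ) * ((psi (c * g * k₂))⁻¹ *
              P.eval (Real.log (qhat q ^ Δ' / ((c * g * k₂ : ℕ) : ℝ)) / Real.log (qhat q ^ Δ'))) / ((c * g * k₂ : ℕ) : ℝ)) *
            (∑ d ∈ k₁.divisors, ∑ e ∈ k₂.divisors,
              ∫ u₁ in Ioi (0 : ℝ),
                (Real.log (qhat q / ((k₁ / d * (g * e) : ℕ) : ℝ)) + Real.log u₁) ^ 0 *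
                ∫ u₂ in Ioi ((((k₁ / d * (g * e) * (g * d * (k₂ / e)) : ℕ) : ℝ) / qhat q ^ 2) / u₁),
                  Real.exp (-(u₁ + u₂)) / (1 - Real.exp (-(u₁ + u₂))) ^ 2 *
                  (Real.log (qhat q / ((g * d * (k₂ / e) : ℕ) : ℝ)) + Real.log u₂) ^ 4)) -
          2 * (π ^ 2 / 6) ^ 2 * (qhat q / (Δ' ^ 2 * Real.log (qhat q) ^ 2)) *
            (Δ' ^ 2 * (Δ' ^ 2 * 𝔎₀₄ (1 / Δ') P) / (2 * (π ^ 2 / 6) ^ 2))| ≤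
          C * qhat q * (Real.log (qhat q))⁻¹ ^ 3 := fun P' hP' Δ'' h1' h2' ↦ by
    rw [e₀₄ Δ'' P']
    exact orderZeroFour_target hΔ P' hP' Δ'' h1' h2'
  have h24 : ∀ P : ℝ[X], KMV2000.Admissible P → ∀ Δ' : ℝ, 1 < Δ' → Δ' ≤ Δ →
      ∃ C : ℝ, ∃ q₀ : ℕ, ∀ (q : ℕ) [NeZero q], q₀ ≤ q →
        |(Real.log (qhat q))⁻¹ ^ (2 + 4) * qhat q *
          (∑ c ∈ Icc 1 ⌊qhat q ^ Δ'⌋₊, ∑ g ∈ Icc 1 (⌊qhat q ^ Δ'⌋₊ / c), (μ g : ℝ) * c *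
        ∑ k₁ ∈ Icc 1 (⌊qhat q ^ Δ'⌋₊ / (c * g)), ∑ k₂ ∈ Icc 1 (⌊qhat q ^ Δ'⌋₊ / (c * g)),
          ((μ (c * g * k₁) : ℝ) * ((psi (c * g * k₁))⁻¹ *
              P.eval (Real.log (qhat q ^ Δ' / ((c * g * k₁ : ℕ) : ℝ)) / Real.log (qhat q ^ Δ'))) / ((c * g * k₁ : ℕ) : ℝ)) *
            ((μ (c * g * k₂) : ℝ) * ((psi (c * g * k₂))⁻¹ *
              P.eval (Real.log (qhat q ^ Δ' / ((c * g * k₂ : ℕ) : ℝ)) / Real.log (qhat q ^ Δ'))) / ((c * g * k₂ : ℕ) : ℝ)) *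
            (∑ d ∈ k₁.divisors, ∑ e ∈ k₂.divisors,
              ∫ u₁ in Ioi (0 : ℝ),
                (Real.log (qhat q / ((k₁ / d * (g * e) : ℕ) : ℝ)) + Real.log u₁) ^ 2 *
                ∫ u₂ in Ioi ((((k₁ / d * (g * e) * (g * d * (k₂ / e)) : ℕ) : ℝ) / qhat q ^ 2) / u₁),
                  Real.exp (-(u₁ + u₂)) / (1 - Real.exp (-(u₁ + u₂))) ^ 2 *
                  (Real.log (qhat q / ((g * d * (k₂ / e) : ℕ) : ℝ)) + Real.log u₂) ^ 4)) -
          2 * (π ^ 2 / 6) ^ 2 * (qhat q / (Δ' ^ 2 * Real.log (qhat q) ^ 2)) *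
            (Δ' ^ 2 * (Δ' ^ 4 * 𝔎₂₄ (1 / Δ') P) / (2 * (π ^ 2 / 6) ^ 2))| ≤
          C * qhat q * (Real.log (qhat q))⁻¹ ^ 3 := fun P' hP' Δ'' h1' h2' ↦ by
    rw [e₂₄ Δ'' P']
    exact orderTwoFour_target hΔ P' hP' Δ'' h1' h2'
  have h := diagPart_asymp_of_natDegree_le_four_of_rungFour_targets hΔ 𝔎₀₄ 𝔎₂₄ 𝔎₄₄ h04 h24 h44 hP hQ h1 h2
  rw [e₀₄ Δ' P, e₂₄ Δ' P] at h
  exact h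

end Summit.Parity.GeneralizedHardyLittlewood.Theorems.MomentsBeyondDiagonal.DiagCorner

end
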